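import Summits.SmoothPoincare4.SmoothPoincare4.Theorems.SullivanDualTargetOfSympcap
import Summits.SmoothPoincare4.SmoothPoincare4.Theorems.SullivanDualWitnessChargeHelperEndHolomorphic
import Literature.Geometry.Symplectic.JHolomorphicOn

/-!
# Helper `helper_ltcEndHolomorphic` of the stub `stub_endConfinement`, line `last-twisted-circle`
(crux `Target`, item stmt-SmoothPoincare4-7823, route `SullivanDual`, thesis
`Summit.SmoothPoincare4.SmoothPoincare4.Theses.SullivanDual.Target`)

`stub_endConfinement` is the maximum principle at the STANDARD END of `Σ ∖ p`. This helper supplies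
its three analytic inputs. Let `J` be standard on the punctured `ε`-chart-ball `B_ε` at `p`
(`Dψ ∘ J = J₀ ∘ Dψ` in the flat coordinates `ψ x = ι(e x − e p)`, `e = extChartAt (𝓡 4) p`, encoded
by the displayed `inner … = stdSymplecticForm …` clause, `Dpsi_J`), and let `u : ℂ → Σ ∖ p` be `C^∞`
and `J`-holomorphic on the punctured plane `{z ≠ 0}` (`IsJHolomorphicOn`). Then:

1. on `Ω = {z ≠ 0 ∧ u z ∈ B_ε}` the complex flat coordinates `Y = Ycoord p ∘ u : ℂ → ℂ × ℂ` are
   complex differentiable (`DifferentiableOn ℂ`): the chain rule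
   `d(Y ∘ u)(z) = complexify ∘ Dψ(u z) ∘ du(z)` (`hasMFDerivAt_psi`, pointwise smoothness of `u`),
   `J`-holomorphy `du(iζ) = J du(ζ)` at `z ≠ 0`, standardness `Dψ ∘ J = J₀ ∘ Dψ` and
   `complexify ∘ J₀ = i • complexify` (`complexify_J0`) show that the real derivative commutes
   with `i`, hence is complex linear (`exists_restrictScalars_eq_of_map_mul_I`,
   `differentiableAt_iff_restrictScalars`);
2. `Y` is continuous at every `z ≠ 0` with `u z` in the chart source at `p` (such a point lies in
   SOME punctured chart-ball, where `Ycoord p` is `C^∞`, `contMDiffAt_Ycoord`);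
3. the norm identity `‖realify (Ycoord p x)‖ = ‖e x − e p‖⁻¹` (`realify_Ycoord`, `norm_inversion`).

This is the pointwise (`ContMDiffAt` on `{z ≠ 0}`) variant of the tree's `helper_endHolomorphic`
(`SullivanDualWitnessChargeHelperEndHolomorphic.lean`, globally smooth `u`); the proofs are adapted
from there line by line.

References: M. Gromov, *Pseudo holomorphic curves in symplectic manifolds*, Invent. Math. 82
(1985), §2.4.A; C. Hummel, *Gromov's compactness theorem for pseudo-holomorphic curves* (1997),
Ch. I §3 (in complex-analytic coordinates eq. (3.1) is the Cauchy–Riemann system).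
-/

noncomputable section

-- the prescribed namespace `Summit.<P>.<Sub>.…` duplicates `SmoothPoincare4` (P = Sub)
set_option linter.dupNamespace false

open scoped Manifold ContDiff Topology
open Set Filter MeasureTheory Literature.Geometry.Kaehler Literature.Geometry.Symplectic
  Literature.Topology.FourManifolds
open Summit.SmoothPoincare4.SmoothPoincare4.Theorems.WitnessCharge.PencilIncompleteness

namespace Summit.SmoothPoincare4.SmoothPoincare4.Theorems.Target.LastTwistedCircle

/-- Local notation for the model space `ℝ⁴`. -/
local notation "E4" => EuclideanSpace ℝ (Fin 4)

variable {S : HomotopySphere 4} {p : S.carrier} {ε' : ℝ} {u : ℂ → punctured p}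

/-! ### The chain rule for `Ycoord ∘ u` under pointwise smoothness of `u` -/

/-- **Chain rule in the flat end, pointwise form.** If `u : ℂ → Σ ∖ p` is `C^∞` at `ξ` and
`u ξ` lies in the punctured `ε'`-chart-ball, then `Ycoord p ∘ u = complexify ∘ ψ ∘ u` has the
(manifold) derivative `complexify ∘ Dψ(u ξ) ∘ du(ξ)` at `ξ`.
(Adapted from `hasMFDerivAt_Ycoord_comp`, which assumes `u` globally `C^∞`.) [folklore] -/
theorem hasMFDerivAt_Ycoord_comp_of_contMDiffAt {ξ : ℂ}
    (hu : ContMDiffAt 𝓘(ℝ, ℂ) (𝓡 4) ∞ u ξ) (hx : InPuncturedChartBall p ε' (u ξ)) :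
    HasMFDerivAt 𝓘(ℝ, ℂ) 𝓘(ℝ, ℂ × ℂ) (fun ξ : ℂ => Ycoord p (u ξ)) ξ
      (complexifyL.comp ((Dpsi p (u ξ)).comp (mfderiv 𝓘(ℝ, ℂ) (𝓡 4) u ξ))) := by
  have hψ : HasMFDerivAt (𝓡 4) 𝓘(ℝ, E4) (psi p) (u ξ) (Dpsi p (u ξ)) := hasMFDerivAt_psi hx
  have hc : HasMFDerivAt 𝓘(ℝ, E4) 𝓘(ℝ, ℂ × ℂ) complexifyL (psi p (u ξ)) complexifyL :=
    hasMFDerivAt_iff_hasFDerivAt.2 complexifyL.hasFDerivAt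
  have hu' : HasMFDerivAt 𝓘(ℝ, ℂ) (𝓡 4) u ξ (mfderiv 𝓘(ℝ, ℂ) (𝓡 4) u ξ) :=
    (hu.mdifferentiableAt (by simp)).hasMFDerivAt
  have h1 : HasMFDerivAt 𝓘(ℝ, ℂ) 𝓘(ℝ, ℂ × ℂ) (complexifyL ∘ (psi p ∘ u)) ξ
      (complexifyL.comp ((Dpsi p (u ξ)).comp (mfderiv 𝓘(ℝ, ℂ) (𝓡 4) u ξ))) :=
    hc.comp ξ (hψ.comp ξ hu')
  have hfun : (complexifyL ∘ (psi p ∘ u) : ℂ → ℂ × ℂ) = fun ξ : ℂ => Ycoord p (u ξ) :=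
    funext fun ξ => (Ycoord_eq_complexify p (u ξ)).symm
  rwa [hfun] at h1

/-- Pointwise form of the chain rule for the Fréchet derivative (`mfderiv = fderiv` between vector
spaces): `d(Ycoord ∘ u)(ξ) ζ = complexify (Dψ(u ξ) (du(ξ) ζ))`. [folklore] -/
theorem fderiv_Ycoord_comp_apply_of_contMDiffAt {ξ : ℂ}
    (hu : ContMDiffAt 𝓘(ℝ, ℂ) (𝓡 4) ∞ u ξ) (hx : InPuncturedChartBall p ε' (u ξ)) (ζ : ℂ) :
    fderiv ℝ (fun ξ : ℂ => Ycoord p (u ξ)) ξ ζ =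
      complexify (Dpsi p (u ξ) (mfderiv 𝓘(ℝ, ℂ) (𝓡 4) u ξ ζ)) := by
  have h := (hasMFDerivAt_Ycoord_comp_of_contMDiffAt hu hx).mfderiv
  rw [mfderiv_eq_fderiv] at h
  exact DFunLike.congr_fun h ζ

/-- `Ycoord ∘ u` is real differentiable at `ξ`. [folklore] -/
theorem differentiableAt_real_Ycoord_comp_of_contMDiffAt {ξ : ℂ}
    (hu : ContMDiffAt 𝓘(ℝ, ℂ) (𝓡 4) ∞ u ξ) (hx : InPuncturedChartBall p ε' (u ξ)) :
    DifferentiableAt ℝ (fun ξ : ℂ => Ycoord p (u ξ)) ξ :=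
  (hasMFDerivAt_Ycoord_comp_of_contMDiffAt hu hx).mdifferentiableAt.differentiableAt

/-! ### Complex linearity of the derivative for `u` `J`-holomorphic on a set and `J` standard -/

/-- For `J` standard on the punctured `ε'`-chart-ball and `u` `J`-holomorphic on `U ∋ ξ`, `C^∞` at
`ξ` with `u ξ ∈ B_{ε'}`, the real derivative of `Ycoord ∘ u` at `ξ` commutes with multiplication by
`i`: `d(Y ∘ u)(ξ)(iζ) = complexify (Dψ (J du ζ)) = complexify (J₀ (Dψ du ζ)) = i • d(Y ∘ u)(ξ) ζ`.
[folklore] -/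
theorem fderiv_Ycoord_comp_mul_I_of_contMDiffAt
    (J : ∀ x : punctured p, TangentSpace (𝓡 4) x →L[ℝ] TangentSpace (𝓡 4) x)
    (hJstd : ∀ x : punctured p, InPuncturedChartBall p ε' x →
      ∀ (v : TangentSpace (𝓡 4) x) (b : E4),
        inner ℝ (fderiv ℝ inversion (extChartAt (𝓡 4) p x.1 - extChartAt (𝓡 4) p p)
          (mfderiv (𝓡 4) 𝓘(ℝ, E4) (fun z : punctured p => extChartAt (𝓡 4) p z.1) x (J x v))) b =
        stdSymplecticForm (fderiv ℝ inversion (extChartAt (𝓡 4) p x.1 - extChartAt (𝓡 4) p p)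
          (mfderiv (𝓡 4) 𝓘(ℝ, E4) (fun z : punctured p => extChartAt (𝓡 4) p z.1) x v)) b)
    {U : Set ℂ} (hhol : IsJHolomorphicOn (𝓡 4) J u U) {ξ : ℂ} (hξ : ξ ∈ U)
    (hu : ContMDiffAt 𝓘(ℝ, ℂ) (𝓡 4) ∞ u ξ) (hx : InPuncturedChartBall p ε' (u ξ)) (ζ : ℂ) :
    fderiv ℝ (fun ξ : ℂ => Ycoord p (u ξ)) ξ (Complex.I * ζ) =
      Complex.I • fderiv ℝ (fun ξ : ℂ => Ycoord p (u ξ)) ξ ζ := by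
  rw [fderiv_Ycoord_comp_apply_of_contMDiffAt hu hx, fderiv_Ycoord_comp_apply_of_contMDiffAt hu hx,
    hhol ξ hξ ζ, Dpsi_J J hJstd hx, complexify_J0, I_smul_prod]

/-- Hence `Ycoord ∘ u` is complex differentiable at such a point `ξ` (a real continuous linear map
`ℂ → ℂ × ℂ` commuting with `i` is complex linear). [folklore] -/
theorem differentiableAt_Ycoord_comp_of_contMDiffAt
    (J : ∀ x : punctured p, TangentSpace (𝓡 4) x →L[ℝ] TangentSpace (𝓡 4) x)
    (hJstd : ∀ x : punctured p, InPuncturedChartBall p ε' x →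
      ∀ (v : TangentSpace (𝓡 4) x) (b : E4),
        inner ℝ (fderiv ℝ inversion (extChartAt (𝓡 4) p x.1 - extChartAt (𝓡 4) p p)
          (mfderiv (𝓡 4) 𝓘(ℝ, E4) (fun z : punctured p => extChartAt (𝓡 4) p z.1) x (J x v))) b =
        stdSymplecticForm (fderiv ℝ inversion (extChartAt (𝓡 4) p x.1 - extChartAt (𝓡 4) p p)
          (mfderiv (𝓡 4) 𝓘(ℝ, E4) (fun z : punctured p => extChartAt (𝓡 4) p z.1) x v)) b)
    {U : Set ℂ} (hhol : IsJHolomorphicOn (𝓡 4) J u U) {ξ : ℂ} (hξ : ξ ∈ U)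
    (hu : ContMDiffAt 𝓘(ℝ, ℂ) (𝓡 4) ∞ u ξ) (hx : InPuncturedChartBall p ε' (u ξ)) :
    DifferentiableAt ℂ (fun ξ : ℂ => Ycoord p (u ξ)) ξ := by
  rw [differentiableAt_iff_restrictScalars ℝ (differentiableAt_real_Ycoord_comp_of_contMDiffAt hu hx)]
  exact exists_restrictScalars_eq_of_map_mul_I _ fun ζ =>
    fderiv_Ycoord_comp_mul_I_of_contMDiffAt J hJstd hhol hξ hu hx ζ

/-! ### Continuity on the chart source and the norm identity -/

/-- A point of `Σ ∖ p` in the chart source at `p` lies in SOME punctured chart-ball at `p`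
(radius `dist (e x) (e p) + 1`). [folklore] -/
theorem inPuncturedChartBall_of_mem_source {x : punctured p} (hx : x.1 ∈ (chartAt E4 p).source) :
    InPuncturedChartBall p (dist (extChartAt (𝓡 4) p x.1) (extChartAt (𝓡 4) p p) + 1) x :=
  ⟨hx, Metric.mem_ball.2 (lt_add_one _)⟩

/-- `Ycoord p ∘ u` is continuous at a point `ξ` where `u` is `C^∞` and `u ξ` lies in the chart
source at `p` (there `Ycoord p` is `C^∞`, `contMDiffAt_Ycoord`). [folklore] -/
theorem continuousAt_Ycoord_comp_of_contMDiffAt {ξ : ℂ} (hu : ContMDiffAt 𝓘(ℝ, ℂ) (𝓡 4) ∞ u ξ)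
    (hx : (u ξ).1 ∈ (chartAt E4 p).source) :
    ContinuousAt (fun ξ : ℂ => Ycoord p (u ξ)) ξ :=
  ((contMDiffAt_Ycoord (inPuncturedChartBall_of_mem_source hx)).comp ξ hu).continuousAt

/-- The norm identity `‖realify (Ycoord p x)‖ = ‖e x − e p‖⁻¹` (`realify ∘ Ycoord p = ι(e − e p)` and
`‖ι z‖ = ‖z‖⁻¹`; valid everywhere, including junk values). [folklore] -/
theorem norm_realify_Ycoord (x : punctured p) :
    ‖realify (Ycoord p x)‖ = ‖extChartAt (𝓡 4) p x.1 - extChartAt (𝓡 4) p p‖⁻¹ := by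
  rw [realify_Ycoord, norm_inversion]

/-! ### The helper -/

/-- **Helper L1 (`helper_ltcEndHolomorphic`): holomorphy in the standard end along a punctured
`J`-holomorphic plane.** For `J` standard on the punctured `ε`-chart-ball `B_ε` at `p` and
`u : ℂ → Σ ∖ p` of class `C^∞` and `J`-holomorphic on `{z ≠ 0}`: (1) the flat complex coordinates
`Ycoord p ∘ u` are complex differentiable on `{z ≠ 0 ∧ u z ∈ B_ε}`; (2) `Ycoord p ∘ u` is continuous
at every `z ≠ 0` with `u z` in the chart source at `p`; (3) `‖realify (Ycoord p x)‖ = ‖e x − e p‖⁻¹`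
on the chart source. (The hypotheses `0 < ε` and `closedBall (e p) ε ⊆ e.target` of the stub are
not needed for these three facts.) [folklore] -/
theorem helper_ltcEndHolomorphic :
    ∀ (S : HomotopySphere 4) (p : S.carrier) (ε : ℝ)
      (J : ∀ x : punctured p, TangentSpace (𝓡 4) x →L[ℝ] TangentSpace (𝓡 4) x) (u : ℂ → punctured p),
      0 < ε → Metric.closedBall (extChartAt (𝓡 4) p p) ε ⊆ (extChartAt (𝓡 4) p).target →
      (∀ x : punctured p, InPuncturedChartBall p ε x → ∀ (v : TangentSpace (𝓡 4) x) (b : E4),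
        inner ℝ (fderiv ℝ inversion (extChartAt (𝓡 4) p x.1 - extChartAt (𝓡 4) p p)
          (mfderiv (𝓡 4) 𝓘(ℝ, E4) (fun z : punctured p => extChartAt (𝓡 4) p z.1) x (J x v))) b =
        stdSymplecticForm (fderiv ℝ inversion (extChartAt (𝓡 4) p x.1 - extChartAt (𝓡 4) p p)
          (mfderiv (𝓡 4) 𝓘(ℝ, E4) (fun z : punctured p => extChartAt (𝓡 4) p z.1) x v)) b) →
      (∀ z : ℂ, z ≠ 0 → ContMDiffAt 𝓘(ℝ, ℂ) (𝓡 4) ∞ u z) →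
      IsJHolomorphicOn (𝓡 4) J u {z : ℂ | z ≠ 0} →
      DifferentiableOn ℂ (fun z : ℂ => Ycoord p (u z)) {z : ℂ | z ≠ 0 ∧ InPuncturedChartBall p ε (u z)} ∧
      (∀ z : ℂ, z ≠ 0 → (u z).1 ∈ (chartAt E4 p).source → ContinuousAt (fun z : ℂ => Ycoord p (u z)) z) ∧
      (∀ x : punctured p, x.1 ∈ (chartAt E4 p).source →
        ‖realify (Ycoord p x)‖ = ‖extChartAt (𝓡 4) p x.1 - extChartAt (𝓡 4) p p‖⁻¹) := by
  intro S p ε J u _hε _hball hJstd hu hJ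
  refine ⟨fun z hz => ?_, fun z hz hsrc => continuousAt_Ycoord_comp_of_contMDiffAt (hu z hz) hsrc,
    fun x _ => norm_realify_Ycoord x⟩
  exact (differentiableAt_Ycoord_comp_of_contMDiffAt J hJstd hJ (U := {z : ℂ | z ≠ 0}) hz.1
    (hu z hz.1) hz.2).differentiableWithinAt

end Summit.SmoothPoincare4.SmoothPoincare4.Theorems.Target.LastTwistedCircle

end
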